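import Mathlib
import HarnessLib

/-!
# The collision bracket of a sine polynomial factorises through both exchange planes
(crux `EmbeddedDrudeMourre.DrudeDissolution`, item stmt-AtomisticToContinuum-12593; `--supports` file for the
registered sub-goal `bracket_sinePoly_abs_le` of stub B1b″ `stub_excursionSecondDifference` of line
`kinetic-polymer-gas-on-the-time-axis`; closes nothing; lead c13 (process B), 2026-08-17)

WHAT. For the harmonics `f = sin(n·)` the collision bracket of the `(2,2)` process
`[f](k₁,k₂,k₃) = f(k₁) + f(k₂) − f(k₃) − f(k₁+k₂−k₃)` is an EXACT triple product
`[sin(n·)](k₁,k₂,k₃) = 4 sin(n(k₃−k₁)/2)·sin(n(k₃−k₂)/2)·sin(n(k₁+k₂)/2)`     (`bracket_sin_nat_mul`),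
so for a sine polynomial `f = Σ_{i<M} cᵢ sin((i+1)k)` the bracket vanishes to first order on EACH of the
two exchange planes `k₃ ≡ k₁`, `k₃ ≡ k₂` simultaneously:
`|[f](k₁,k₂,k₃)| ≤ (4 Σᵢ|cᵢ|(i+1)²)·|sin((k₃−k₁)/2)|·|sin((k₃−k₂)/2)|`     (`bracket_sinePoly_abs_le`),
using `|sin(nx)| ≤ n|sin x|` (`abs_sin_nat_mul_le`). Moreover the quotient is smooth:
`sin((i+1)x) = sin x · Uᵢ(cos x)` (Chebyshev, Mathlib `Polynomial.Chebyshev.U_real_cos`) gives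
`[f] = 4 sin(s₁/2) sin(s₂/2) · B_f`, `B_f = Σᵢ cᵢ Uᵢ(cos(s₁/2)) Uᵢ(cos(s₂/2)) sin((i+1)(k₁+k₂)/2)`
(`bracket_sinePoly_eq_smooth`).

WHY (role). The weight of the two-phonon density of states is `W = Φ²[f]²/(∏ω)²`, hence
`W = S₁²S₂²·B` with `B` smooth and bounded (`Sᵢ = sin(sᵢ/2)`): the `W ≲ S₁²S₂²`, `|∇W| ≲ |S₁S₂|(|S₁|+|S₂|)`,
`|∇²W| ≲ S₁²+S₂²` inputs of the sup-norm power counting of B1b″, and the `η⁴` bound for the discarded tube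
mass (`sup_{tube} W ≲ η²` times tube volume `≲ η²`).
-/

noncomputable section

open Real Finset
open scoped BigOperators

namespace Summit.AtomisticToContinuum.FouriersLaw.Theorems.DrudeDissolution.KineticPolymerGasOnTheTimeAxis

/-! ### §1 The four-sine identity -/

/-- `sin(z−x+y) + sin(z+x−y) − sin(z+x+y) − sin(z−x−y) = 4 sin x sin y sin z`. [folklore] -/
theorem sin_four_bracket (x y z : ℝ) :
    Real.sin (z - x + y) + Real.sin (z + x - y) - Real.sin (z + x + y) - Real.sin (z - x - y) =
      4 * Real.sin x * Real.sin y * Real.sin z := by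
  simp only [Real.sin_add, Real.sin_sub, Real.cos_add, Real.cos_sub]
  ring

/-- **The bracket of a harmonic is a triple product.**
`sin(nk₁) + sin(nk₂) − sin(nk₃) − sin(n(k₁+k₂−k₃)) = 4 sin(n(k₃−k₁)/2) sin(n(k₃−k₂)/2) sin(n(k₁+k₂)/2)`
for every real `n`. [folklore] -/
theorem bracket_sin_mul (n k₁ k₂ k₃ : ℝ) :
    Real.sin (n * k₁) + Real.sin (n * k₂) - Real.sin (n * k₃) - Real.sin (n * (k₁ + k₂ - k₃)) =
      4 * Real.sin (n * (k₃ - k₁) / 2) * Real.sin (n * (k₃ - k₂) / 2) * Real.sin (n * (k₁ + k₂) / 2) := by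
  have h := sin_four_bracket (n * (k₃ - k₁) / 2) (n * (k₃ - k₂) / 2) (n * (k₁ + k₂) / 2)
  have e1 : n * (k₁ + k₂) / 2 - n * (k₃ - k₁) / 2 + n * (k₃ - k₂) / 2 = n * k₁ := by ring
  have e2 : n * (k₁ + k₂) / 2 + n * (k₃ - k₁) / 2 - n * (k₃ - k₂) / 2 = n * k₂ := by ring
  have e3 : n * (k₁ + k₂) / 2 + n * (k₃ - k₁) / 2 + n * (k₃ - k₂) / 2 = n * k₃ := by ring
  have e4 : n * (k₁ + k₂) / 2 - n * (k₃ - k₁) / 2 - n * (k₃ - k₂) / 2 = n * (k₁ + k₂ - k₃) := by ring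
  rw [e1, e2, e3, e4] at h
  exact h

/-! ### §2 `|sin(nx)| ≤ n|sin x|` -/

/-- `|sin(nx)| ≤ n·|sin x|` for natural `n`. [folklore] -/
theorem abs_sin_nat_mul_le (n : ℕ) (x : ℝ) : |Real.sin (n * x)| ≤ n * |Real.sin x| := by
  induction n with
  | zero => simp
  | succ n ih =>
    have h : Real.sin ((n + 1 : ℕ) * x) = Real.sin (n * x) * Real.cos x + Real.cos (n * x) * Real.sin x := by
      rw [show ((n + 1 : ℕ) : ℝ) * x = n * x + x by push_cast; ring, Real.sin_add]
    rw [h]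
    calc |Real.sin (n * x) * Real.cos x + Real.cos (n * x) * Real.sin x|
        ≤ |Real.sin (n * x) * Real.cos x| + |Real.cos (n * x) * Real.sin x| := abs_add_le _ _
      _ ≤ |Real.sin (n * x)| * 1 + 1 * |Real.sin x| := by
          rw [abs_mul, abs_mul]
          exact add_le_add (mul_le_mul_of_nonneg_left (Real.abs_cos_le_one _) (abs_nonneg _))
            (mul_le_mul_of_nonneg_right (Real.abs_cos_le_one _) (abs_nonneg _))
      _ ≤ n * |Real.sin x| * 1 + 1 * |Real.sin x| := by gcongr
      _ = (n + 1 : ℕ) * |Real.sin x| := by push_cast; ring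

/-- The harmonic bracket is `O(|sin(s₁/2)|·|sin(s₂/2)|)` with constant `4n²`. [folklore] -/
theorem abs_bracket_sin_nat_mul_le (n : ℕ) (k₁ k₂ k₃ : ℝ) :
    |Real.sin (n * k₁) + Real.sin (n * k₂) - Real.sin (n * k₃) - Real.sin (n * (k₁ + k₂ - k₃))| ≤
      4 * n ^ 2 * (|Real.sin ((k₃ - k₁) / 2)| * |Real.sin ((k₃ - k₂) / 2)|) := by
  rw [bracket_sin_mul]
  have h1 := abs_sin_nat_mul_le n ((k₃ - k₁) / 2)
  have h2 := abs_sin_nat_mul_le n ((k₃ - k₂) / 2)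
  have h3 : |Real.sin (n * (k₁ + k₂) / 2)| ≤ 1 := Real.abs_sin_le_one _
  rw [show (n : ℝ) * (k₃ - k₁) / 2 = n * ((k₃ - k₁) / 2) by ring,
    show (n : ℝ) * (k₃ - k₂) / 2 = n * ((k₃ - k₂) / 2) by ring, abs_mul, abs_mul, abs_mul,
    show |(4 : ℝ)| = 4 by norm_num]
  have hn : (0 : ℝ) ≤ n := n.cast_nonneg
  calc 4 * |Real.sin (n * ((k₃ - k₁) / 2))| * |Real.sin (n * ((k₃ - k₂) / 2))| *
        |Real.sin (n * (k₁ + k₂) / 2)|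
      ≤ 4 * (n * |Real.sin ((k₃ - k₁) / 2)|) * (n * |Real.sin ((k₃ - k₂) / 2)|) * 1 := by
        gcongr
    _ = 4 * n ^ 2 * (|Real.sin ((k₃ - k₁) / 2)| * |Real.sin ((k₃ - k₂) / 2)|) := by ring

/-! ### §3 Sine polynomials -/

/-- **The bracket of a sine polynomial vanishes linearly on both exchange planes (registered sub-goal
`bracket_sinePoly_abs_le` of stub B1b″).** For `f = Σ_{i<M} cᵢ sin((i+1)k)` and all `k₁ k₂ k₃`:
`|f(k₁)+f(k₂)−f(k₃)−f(k₁+k₂−k₃)| ≤ (4Σᵢ|cᵢ|(i+1)²)·|sin((k₃−k₁)/2)|·|sin((k₃−k₂)/2)|`. [folklore] -/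
theorem bracket_sinePoly_abs_le :
    ∀ (M : ℕ) (c : Fin M → ℝ) (k₁ k₂ k₃ : ℝ),
      |(∑ i, c i * Real.sin (((i : ℕ) + 1 : ℕ) * k₁)) + (∑ i, c i * Real.sin (((i : ℕ) + 1 : ℕ) * k₂)) -
          (∑ i, c i * Real.sin (((i : ℕ) + 1 : ℕ) * k₃)) -
          (∑ i, c i * Real.sin (((i : ℕ) + 1 : ℕ) * (k₁ + k₂ - k₃)))| ≤
        (4 * ∑ i, |c i| * (((i : ℕ) + 1 : ℕ) : ℝ) ^ 2) *
          (|Real.sin ((k₃ - k₁) / 2)| * |Real.sin ((k₃ - k₂) / 2)|) := by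
  intro M c k₁ k₂ k₃
  have hsum : (∑ i, c i * Real.sin (((i : ℕ) + 1 : ℕ) * k₁)) + (∑ i, c i * Real.sin (((i : ℕ) + 1 : ℕ) * k₂)) -
      (∑ i, c i * Real.sin (((i : ℕ) + 1 : ℕ) * k₃)) -
      (∑ i, c i * Real.sin (((i : ℕ) + 1 : ℕ) * (k₁ + k₂ - k₃))) =
      ∑ i, c i * (Real.sin (((i : ℕ) + 1 : ℕ) * k₁) + Real.sin (((i : ℕ) + 1 : ℕ) * k₂) -
        Real.sin (((i : ℕ) + 1 : ℕ) * k₃) - Real.sin (((i : ℕ) + 1 : ℕ) * (k₁ + k₂ - k₃))) := by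
    simp only [mul_add, mul_sub, Finset.sum_add_distrib, Finset.sum_sub_distrib]
  rw [hsum, Finset.mul_sum, Finset.sum_mul]
  refine (Finset.abs_sum_le_sum_abs _ _).trans (Finset.sum_le_sum fun i _ => ?_)
  rw [abs_mul]
  have h := abs_bracket_sin_nat_mul_le ((i : ℕ) + 1) k₁ k₂ k₃
  calc |c i| * |Real.sin (((i : ℕ) + 1 : ℕ) * k₁) + Real.sin (((i : ℕ) + 1 : ℕ) * k₂) -
        Real.sin (((i : ℕ) + 1 : ℕ) * k₃) - Real.sin (((i : ℕ) + 1 : ℕ) * (k₁ + k₂ - k₃))|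
      ≤ |c i| * (4 * (((i : ℕ) + 1 : ℕ) : ℝ) ^ 2 * (|Real.sin ((k₃ - k₁) / 2)| * |Real.sin ((k₃ - k₂) / 2)|)) :=
        mul_le_mul_of_nonneg_left h (abs_nonneg _)
    _ = 4 * (|c i| * (((i : ℕ) + 1 : ℕ) : ℝ) ^ 2) * (|Real.sin ((k₃ - k₁) / 2)| * |Real.sin ((k₃ - k₂) / 2)|) := by
        ring

/-- **Smooth factorisation of the bracket of a sine polynomial.** With the Chebyshev polynomials of the
second kind `Uᵢ` (`sin((i+1)x) = sin x · Uᵢ(cos x)`), for `f = Σ cᵢ sin((i+1)k)`: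
`[f](k₁,k₂,k₃) = 4 sin((k₃−k₁)/2) sin((k₃−k₂)/2) · Σᵢ cᵢ Uᵢ(cos((k₃−k₁)/2)) Uᵢ(cos((k₃−k₂)/2)) sin((i+1)(k₁+k₂)/2)`.
[folklore] -/
theorem bracket_sinePoly_eq_smooth (M : ℕ) (c : Fin M → ℝ) (k₁ k₂ k₃ : ℝ) :
    (∑ i, c i * Real.sin (((i : ℕ) + 1 : ℕ) * k₁)) + (∑ i, c i * Real.sin (((i : ℕ) + 1 : ℕ) * k₂)) -
        (∑ i, c i * Real.sin (((i : ℕ) + 1 : ℕ) * k₃)) -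
        (∑ i, c i * Real.sin (((i : ℕ) + 1 : ℕ) * (k₁ + k₂ - k₃))) =
      4 * Real.sin ((k₃ - k₁) / 2) * Real.sin ((k₃ - k₂) / 2) *
        ∑ i, c i * ((Polynomial.Chebyshev.U ℝ (i : ℕ)).eval (Real.cos ((k₃ - k₁) / 2)) *
          (Polynomial.Chebyshev.U ℝ (i : ℕ)).eval (Real.cos ((k₃ - k₂) / 2)) *
          Real.sin ((((i : ℕ) + 1 : ℕ) : ℝ) * (k₁ + k₂) / 2)) := by
  have hsum : (∑ i, c i * Real.sin (((i : ℕ) + 1 : ℕ) * k₁)) + (∑ i, c i * Real.sin (((i : ℕ) + 1 : ℕ) * k₂)) -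
      (∑ i, c i * Real.sin (((i : ℕ) + 1 : ℕ) * k₃)) -
      (∑ i, c i * Real.sin (((i : ℕ) + 1 : ℕ) * (k₁ + k₂ - k₃))) =
      ∑ i, c i * (Real.sin (((i : ℕ) + 1 : ℕ) * k₁) + Real.sin (((i : ℕ) + 1 : ℕ) * k₂) -
        Real.sin (((i : ℕ) + 1 : ℕ) * k₃) - Real.sin (((i : ℕ) + 1 : ℕ) * (k₁ + k₂ - k₃))) := by
    simp only [mul_add, mul_sub, Finset.sum_add_distrib, Finset.sum_sub_distrib]
  rw [hsum, Finset.mul_sum]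
  refine Finset.sum_congr rfl fun i _ => ?_
  rw [bracket_sin_mul]
  -- `sin((i+1)θ) = sin θ · Uᵢ(cos θ)` at `θ = s₁/2, s₂/2`
  have hU : ∀ θ : ℝ, Real.sin ((((i : ℕ) + 1 : ℕ) : ℝ) * θ) =
      (Polynomial.Chebyshev.U ℝ (i : ℕ)).eval (Real.cos θ) * Real.sin θ := by
    intro θ
    have h := Polynomial.Chebyshev.U_real_cos θ ((i : ℕ) : ℤ)
    rw [h]
    congr 1
    push_cast
    ring
  have h1 : Real.sin ((((i : ℕ) + 1 : ℕ) : ℝ) * (k₃ - k₁) / 2) =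
      (Polynomial.Chebyshev.U ℝ (i : ℕ)).eval (Real.cos ((k₃ - k₁) / 2)) * Real.sin ((k₃ - k₁) / 2) := by
    rw [show ((((i : ℕ) + 1 : ℕ) : ℝ)) * (k₃ - k₁) / 2 = (((i : ℕ) + 1 : ℕ) : ℝ) * ((k₃ - k₁) / 2) by ring]
    exact hU _
  have h2 : Real.sin ((((i : ℕ) + 1 : ℕ) : ℝ) * (k₃ - k₂) / 2) =
      (Polynomial.Chebyshev.U ℝ (i : ℕ)).eval (Real.cos ((k₃ - k₂) / 2)) * Real.sin ((k₃ - k₂) / 2) := by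
    rw [show ((((i : ℕ) + 1 : ℕ) : ℝ)) * (k₃ - k₂) / 2 = (((i : ℕ) + 1 : ℕ) : ℝ) * ((k₃ - k₂) / 2) by ring]
    exact hU _
  rw [h1, h2]
  ring

end Summit.AtomisticToContinuum.FouriersLaw.Theorems.DrudeDissolution.KineticPolymerGasOnTheTimeAxis

end
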